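import Summits.QuantumFields.YangMills.Theorems.BalabanLadderIRColdDefectCouplingSign
import Summits.QuantumFields.YangMills.Theorems.BalabanLadderIRColdPurityQuarterDoorSU2
import Literature.MathematicalPhysics.QuantumLattice.RepLieAlgebraUnitary
import Literature.Analysis.FunctionSpaces.BesselMoments
import HarnessLib

/-!
# Sketch g3 — crux idea `spectral-tilt` on `BalabanLadder.IRcof` (stmt-QuantumFields-26930), lens oqh, ideator ym-ir-idea-30 g3

Pays the three prices of crit-3 g5 (bus l.1660) on the g2 sheet `SPECTRAL_TILT_SHEET_ym_ir_idea_30_g2.lean`, whose declarations are reproduced VERBATIM in §0 below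
(crux workfiles are not built modules, so the g2 sheet cannot be imported; this file is self-contained and SUPERSEDES it):

* **P1 (typing).**  The `∃`-Props `StrongCouplingSignSU2`, `TubeCertificate8` book no NUMBER.  Here they are
  re-typed with explicit parameters (`StrongCouplingSignSU2At β₁`, `TubeCertificate8At β₁ R`), proved equal to the
  `∃`-closures of the g2 names, and given TARGET instances with stated rationals (`…Target`) and today's
  KP-certifiable rung box (`…KPRung`).  Units: `β` is the TREE coupling (`β_W = 2β`); `u(β) = I₂(2β)/I₁(2β)`.
* **P2 (what «uniform in the tube length» must mean).**  Finding: a single dressed tube weight with an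
  `L`-independent relative error is false beyond relative order `t·u⁴` (glueball hopping; the printed general-`N_t`
  coefficients of Langelage–Münster–Philipsen JHEP 07 (2008) 036 = arXiv:0805.1163 §3 grow with `N_t`).  The correct
  uniform object is the band ∕ momentum-resolved glueball gas = the transfer-matrix eigenvalue RATIOS the g2 lever
  already consumes.  Typed: `RatioDominationAt β₁` (P2-sign: gap contraction per spatial torus, `t` never enters;
  wiring to MONO⁺ via `GapDominationMono` PROVED by name) and `DressedBandGasAt β₁ C` (P2-numbers: `L`-independent
  bands on the Brillouin 3-torus, relative error `C·u²`; PROVED: `+ C·u² ≤ 1 ⇒ StrongCouplingSignSU2At β₁`).  Both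
  TO-BE-PROVED; no rigorous finite-torus statement located in print (nearest: convergent SC glueball-mass expansions,
  Schor 1983/84, O'Carroll–Barbosa 1985, Faria da Veiga–O'Carroll 2026 — infinite spatial volume, small β, β-range open).
* **P3.**  `TubeCertificate8At` instances are TARGETS ∕ GUIDANCE until a remainder with explicit `(β₁, R)` lands;
  exact orders (E2-TUBE) move no certified ceiling (R6: `K·q·E < 1` is order-independent).

HONEST: nothing here proves IRcof, IR, PX(1/24), PXcof(1/24), N_cof or the Yang–Mills mass gap; instrument side, width 0.
-/

noncomputable section

open Set Filter Topology
open Literature.MathematicalPhysics.QuantumFieldTheory Literature.MathematicalPhysics.QuantumLattice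
open Literature.Analysis.FunctionSpaces (besselI)
open Summit.QuantumFields.YangMills.Cruxes.IR.ColdPurityBridge (coldDefect)
open Summit.QuantumFields.YangMills.Cruxes.IR.CouplingAxis.Sign (monotoneOn_coldDefect_of_actionDefect_nonneg)

namespace Summit.QuantumFields.YangMills.Cruxes.IRcof.SpectralTilt

/-! ## §0 — the g2 sheet, verbatim (actionDefectSU2, StrongCouplingSignSU2, the p685221 composition, TiltLemma, GapDominationMono, TubeCertificate8) -/

/-- The action-additivity defect under time doubling for the `SU(2)` fundamental Wilson theory,
`A_β(L) := ⟨S⟩_{β; L³×2⌊L/4⌋} − 2⟨S⟩_{β; L³×⌊L/4⌋}` (tree coupling `β`, `β_W = 2β`), spelled exactly as the hypothesis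
`hA` of `CouplingAxis.Sign.monotoneOn_coldDefect_of_actionDefect_nonneg`. -/
def actionDefectSU2 (β : ℝ) (L : ℕ) : ℝ :=
  finTorusExpectation (fundamentalLatticeRep 2).ρ β
      (finTorusWilsonAction (n₀ := L) (n₁ := L) (n₂ := L) (n₃ := 2 * (L / 4)) (fundamentalLatticeRep 2).ρ) -
    2 * finTorusExpectation (fundamentalLatticeRep 2).ρ β
      (finTorusWilsonAction (n₀ := L) (n₁ := L) (n₂ := L) (n₃ := L / 4) (fundamentalLatticeRep 2).ρ)

/-- **FIRST LEMMA (a-SC) — strong-coupling sign of the action defect, UNIFORM in the box.**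
There is `β₁ > 0` such that for every side `L ≥ 8` and every tree coupling `β ∈ [0, β₁]`, `0 ≤ A_β(L)`.
(Mechanism: time-wrapping flux-tube sector of the finite-size character ∕ polymer expansion,
`F_β(L) = −log(Z_{2t}/Z_t²) = 6L³u^{4t} − 3L³u^{8t} + …`, `u = I₂(2β)/I₁(2β)`, with the tube decorations exponentiated into
the strong-coupling glueball mass `m(u) = −4 log u + 2u² − …`, `m'(β) < 0`; the uniformity in `L` is the content.) -/
def StrongCouplingSignSU2 : Prop :=
  ∃ β₁ : ℝ, 0 < β₁ ∧ ∀ L : ℕ, 8 ≤ L → ∀ β ∈ Icc (0 : ℝ) β₁, 0 ≤ actionDefectSU2 β L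

/-- BY-NAME COMPOSITION with the LEAD's MONO⁺ (`CouplingAxis.Sign.monotoneOn_coldDefect_of_actionDefect_nonneg`):
the strong-coupling sign makes `β ↦ δᶜ_β(L)` non-decreasing on `[0, β₁]` for every `L ≥ 8` (so the `1/24`-pure couplings of the
box form an initial segment there, `coldDefect_le_of_le_of_actionDefect_nonneg`). -/
theorem monotoneOn_coldDefect_of_strongCouplingSign (h : StrongCouplingSignSU2) :
    ∃ β₁ : ℝ, 0 < β₁ ∧ ∀ L : ℕ, 8 ≤ L →
      MonotoneOn (fun β : ℝ => coldDefect (fundamentalLatticeRep 2).ρ β L) (Icc (0 : ℝ) β₁) := by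
  obtain ⟨β₁, hβ₁, hA⟩ := h
  exact ⟨β₁, hβ₁, fun L hL =>
    monotoneOn_coldDefect_of_actionDefect_nonneg (fundamentalLatticeRep 2) L (convex_Icc 0 β₁) (hA L hL)⟩

/-- **SPECTRAL TILT LEMMA (pure analysis; the structural lever).**  For two families of transfer-matrix eigenvalue
ratios `r ≤ r'` pointwise in `[0,1]` (vacuum index `i₀`, `r i₀ = r' i₀ = 1`) with thermal traces
`1 + x_T = Σᵢ rᵢ^T` at `T = t, 2t`, the purity ratio `(1 + x_{2t})/(1 + x_t)²` is SMALLER for the dominating family,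
provided the cold side condition `r'ᵢ^t (1 + x'_t) ≤ 1` (`i ≠ i₀`).  (Gradient of `Φ(r) = (1+Σr^{2t})/(1+Σr^t)²`:
`∂ⱼΦ ∝ rⱼ^{t-1}(rⱼ^t(1+x_t) − (1+x_{2t})) ≤ 0` on the cold region.)  With the tree's spectral bookkeeping
`DoublingDefect.exists_ratios_hasSum_traceExcess` (`Z_β(N³×T) = λ₊^T Σ rᵢ^T`) this turns GAP CONTRACTION in the coupling
(every ratio `λᵢ/λ₊` non-decreasing in `β`) into MONO⁺ without differentiating eigenvalues. -/
def TiltLemma : Prop :=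
  ∀ (ι : Type) [DecidableEq ι] (i₀ : ι) (t : ℕ), 1 ≤ t →
    ∀ r r' : ι → ℝ, (∀ i, 0 ≤ r i) → (∀ i, r i ≤ r' i) → (∀ i, r' i ≤ 1) → r i₀ = 1 → r' i₀ = 1 →
    ∀ x₁ x₂ x₁' x₂' : ℝ,
      HasSum (Function.update (fun i => r i ^ t) i₀ 0) x₁ →
      HasSum (Function.update (fun i => r i ^ (2 * t)) i₀ 0) x₂ →
      HasSum (Function.update (fun i => r' i ^ t) i₀ 0) x₁' →
      HasSum (Function.update (fun i => r' i ^ (2 * t)) i₀ 0) x₂' →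
      (∀ i, i ≠ i₀ → r' i ^ t * (1 + x₁') ≤ 1) →
      (1 + x₂') / (1 + x₁') ^ 2 ≤ (1 + x₂) / (1 + x₁) ^ 2

/-- **GAP DOMINATION ⇒ MONO⁺ (the typed target the tilt lemma serves), `SU(2)`, one box.**  On a set `D` of couplings:
if for `β ≤ β'` in `D` the cold tori `L³×⌊L/4⌋`, `L³×2⌊L/4⌋` admit spectral data on a common index with pointwise
dominated ratios and the cold side condition at `β'`, then `δᶜ_β(L) ≤ δᶜ_{β'}(L)`.  Stated with the partition functions and
`transferSpectralRadius` exactly as in `exists_ratios_hasSum_traceExcess`. -/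
def GapDominationMono (L : ℕ) [NeZero L] (D : Set ℝ) : Prop :=
  (∀ β ∈ D, ∀ β' ∈ D, β ≤ β' →
    ∃ (ι : Type) (_ : DecidableEq ι) (i₀ : ι) (r r' : ι → ℝ),
      (∀ i, 0 ≤ r i) ∧ (∀ i, r i ≤ r' i) ∧ (∀ i, r' i ≤ 1) ∧ r i₀ = 1 ∧ r' i₀ = 1 ∧
      (∀ T ∈ ({L / 4, 2 * (L / 4)} : Set ℕ),
        HasSum (fun i => r i ^ T)
          (wilsonFinTorusPartition (fundamentalLatticeRep 2).ρ β L L L T /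
            transferSpectralRadius (fundamentalLatticeRep 2).ρ β L ^ T) ∧
        HasSum (fun i => r' i ^ T)
          (wilsonFinTorusPartition (fundamentalLatticeRep 2).ρ β' L L L T /
            transferSpectralRadius (fundamentalLatticeRep 2).ρ β' L ^ T)) ∧
      (∀ i, i ≠ i₀ → r' i ^ (L / 4) *
        (wilsonFinTorusPartition (fundamentalLatticeRep 2).ρ β' L L L (L / 4) /
          transferSpectralRadius (fundamentalLatticeRep 2).ρ β' L ^ (L / 4)) ≤ 1)) →
  MonotoneOn (fun β : ℝ => coldDefect (fundamentalLatticeRep 2).ρ β L) D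

/-- **TUBE CERTIFICATE at the instrument box `L = 8` (`t = 2`) — shape of deliverable (b).**  The cold defect of the
`8³×(2,4)` pair is the wrapping-tube term `6·8³·u⁸` up to a remainder of relative order `u²` on an initial coupling segment:
`|δᶜ_β(8) − 3072·u(β)⁸| ≤ R·u(β)^{10}` for `β ∈ [0, β₁]`, `u(β) = I₂(2β)/I₁(2β)`.  (True near `0` by analyticity; the NUMBER —
how large `β₁` can be certified with which `R` — is the eng ∕ prover content, cf. the E2-TUBE ask.) -/
def TubeCertificate8 : Prop :=
  ∃ β₁ R : ℝ, 0 < β₁ ∧ 0 ≤ R ∧ ∀ β ∈ Icc (0 : ℝ) β₁,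
    |coldDefect (fundamentalLatticeRep 2).ρ β 8 -
        3072 * (besselI 2 (2 * β) / besselI 1 (2 * β)) ^ 8| ≤
      R * (besselI 2 (2 * β) / besselI 1 (2 * β)) ^ 10


/-- The `SU(2)` strong-coupling character ratio at TREE coupling `β` (`β_W = 2β`): `u(β) = I₂(2β)/I₁(2β)`
(`= β_W/4 − β_W³/96 + …`, [LMP08 §2]). -/
def uSU2 (β : ℝ) : ℝ := besselI 2 (2 * β) / besselI 1 (2 * β)

/-! ## P1 — parametrised re-typing of the g2 `∃`-Props, with target instances -/

/-- **(a-SC) with the segment as a PARAMETER.**  `0 < β₁` and `A_β(L) ≥ 0` for every side `L ≥ 8` and every tree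
coupling `β ∈ [0, β₁]`. -/
def StrongCouplingSignSU2At (β₁ : ℝ) : Prop :=
  0 < β₁ ∧ ∀ L : ℕ, 8 ≤ L → ∀ β ∈ Icc (0 : ℝ) β₁, 0 ≤ actionDefectSU2 β L

theorem strongCouplingSignSU2_iff : StrongCouplingSignSU2 ↔ ∃ β₁ : ℝ, StrongCouplingSignSU2At β₁ := Iff.rfl

/-- **Tube certificate at `L = 8` with `(β₁, R)` as PARAMETERS:** `|δᶜ_β(8) − 3072·u(β)⁸| ≤ R·u(β)^{10}` on `[0, β₁]`. -/
def TubeCertificate8At (β₁ R : ℝ) : Prop :=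
  0 < β₁ ∧ 0 ≤ R ∧ ∀ β ∈ Icc (0 : ℝ) β₁,
    |coldDefect (fundamentalLatticeRep 2).ρ β 8 - 3072 * uSU2 β ^ 8| ≤ R * uSU2 β ^ 10

theorem tubeCertificate8_iff : TubeCertificate8 ↔ ∃ β₁ R : ℝ, TubeCertificate8At β₁ R := Iff.rfl

/-- Monotonicity of the parametrised Props in their parameters (a larger segment ∕ smaller constant is stronger). -/
theorem StrongCouplingSignSU2At.mono {β₁ β₁' : ℝ} (h : StrongCouplingSignSU2At β₁') (h0 : 0 < β₁) (hle : β₁ ≤ β₁') :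
    StrongCouplingSignSU2At β₁ :=
  ⟨h0, fun L hL β hβ => h.2 L hL β ⟨hβ.1, hβ.2.trans hle⟩⟩

theorem TubeCertificate8At.mono {β₁ β₁' R R' : ℝ} (h : TubeCertificate8At β₁' R) (h0 : 0 < β₁) (hle : β₁ ≤ β₁')
    (hR : R ≤ R') : TubeCertificate8At β₁ R' := by
  refine ⟨h0, h.2.1.trans hR, fun β hβ => (h.2.2 β ⟨hβ.1, hβ.2.trans hle⟩).trans ?_⟩
  have hu : 0 ≤ uSU2 β ^ 10 := by
    have : uSU2 β ^ 10 = (uSU2 β ^ 5) ^ 2 := by ring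
    rw [this]; positivity
  exact mul_le_mul_of_nonneg_right hR hu

/-- **TARGET instance (what the line needs; UNCERTIFIED).**  Tree `β₁ = 11/20`, i.e. `β_W = 1.1`, just above the
E2-TUBE crossing bracket `β×_W ∈ [1.02, 1.08]` where the series value of `δᶜ(8)` passes `1/24` (PREREG-E2-TUBE R5,
GUIDANCE); there `u ≈ 0.265`. -/
def StrongCouplingSignSU2Target : Prop := StrongCouplingSignSU2At (11 / 20)

/-- **TARGET instance of the tube certificate (UNCERTIFIED; numbers GUIDANCE-derived).**  `β₁ = 11/20` (tree), `R = 2¹⁴`: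
from the printed series `δᶜ(8) = 3072u⁸(1 − 4u² + 110/3·u⁴ − 58472/405·u⁶ + …) − (3072u⁸)²/2 + …` [LMP08 §3, N_t = 2, 4]
the ratio `|δᶜ(8) − 3072u⁸|/u^{10}` stays below `≈ 7·10³ < 16384` on `u ∈ [0, 0.265]` IF the series tail behaves — a
remainder with explicit `(β₁, R)` is the prover ∕ eng content (P3). -/
def TubeCertificate8Target : Prop := TubeCertificate8At (11 / 20) 16384

/-- **KP RUNG box (today's certifiable segment; R still to be produced).**  Tree `β₁ = 1/32`, i.e. `β_W = 1/16 = 0.0625`,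
inside the SUP-norm Kotecký–Preiss ceiling `β_W < 0.0653` of the current activity bound (crit-3 R6, eng-2 PREREG F6);
the method wall between this rung and the target is R6-(i) an entropy constant for CLOSED supports and R6-(ii) a
character-basis activity norm (small parameter `u·K_closed` instead of `q·K`). -/
def TubeCertificate8KPRung : Prop := ∃ R : ℝ, TubeCertificate8At (1 / 32) R

/-! ## P2 — what «uniform in the length `t = ⌊L/4⌋`» must mean (typed)

**Finding (g3).**  The naive uniform statement — ONE dressed tube weight `w(β) = e^{−m(β)}` per time slice with an
`L`-independent relative error `C·u²` — is FALSE beyond relative order `t·u⁴`: the printed general-`N_t` series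
`f(N_t,u) = −(3/N_t)u^{4N_t}c^{N_t}[1 + 12N_t u⁴ − (1556/81)N_t u⁶ + (83N_t² + …)u⁸ + …]` [LMP08 §3] has coefficients growing
with `N_t` (glueball HOPPING, band width `O(u⁴)` relative; channel splitting `m(E⁺⁺) − m(A₁⁺⁺) = 24u⁴ + …`).  The correct
`t`-uniform object is the band ∕ momentum-resolved free glueball gas, i.e. the eigenvalue RATIOS of the time transfer
matrix on the spatial torus `L³` — which is exactly what the g2 lever (`TiltLemma`, `GapDominationMono`) consumes, with NO
expansion in `t` at all.  So P2 splits into: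
* (P2-sign) `RatioDominationAt β₁`: for every `L ≥ 8` and `β ≤ β'` in `[0, β₁]`, pointwise domination of the ratio families
  (+ the cold side condition) — the antecedent of `GapDominationMono L (Icc 0 β₁)`; per spatial torus, `t` never enters;
  the strong-coupling cluster expansion is needed only for `β ↦ λ_s(β)/λ₊(β)` non-decreasing (GAP CONTRACTION), whose
  nearest rigorous print is the convergent SC glueball-mass expansions (Schor 1983/84; O'Carroll–Barbosa 1985; Faria da
  Veiga–O'Carroll 2026, who print the β-range as open).  TO-BE-PROVED.
* (P2-numbers) `DressedBandGasAt β₁ C`: the band-resolved dressed gas with `L`-independent bands on the Brillouin 3-torus,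
  relative error `C·u²` uniform in `L` — a precision statement (feeds tube certificates at every `t`, not needed for the
  sign beyond the PROVED reduction below).  TO-BE-PROVED; plausibility caveat: multi-glueball interactions enter at relative
  `O(L³w^t)`, largest at `L = 8`.
-/

/-- The antecedent of `GapDominationMono L D` as a named Prop: spectral data of the cold tori at `β ≤ β'` in `D` on a common
index, ratios pointwise dominated (`r ≤ r' ≤ 1`, vacuum index with ratio `1`), and the cold side condition at `β'`. -/
def RatioDomination (L : ℕ) [NeZero L] (D : Set ℝ) : Prop :=
  ∀ β ∈ D, ∀ β' ∈ D, β ≤ β' →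
    ∃ (ι : Type) (_ : DecidableEq ι) (i₀ : ι) (r r' : ι → ℝ),
      (∀ i, 0 ≤ r i) ∧ (∀ i, r i ≤ r' i) ∧ (∀ i, r' i ≤ 1) ∧ r i₀ = 1 ∧ r' i₀ = 1 ∧
      (∀ T ∈ ({L / 4, 2 * (L / 4)} : Set ℕ),
        HasSum (fun i => r i ^ T)
          (wilsonFinTorusPartition (fundamentalLatticeRep 2).ρ β L L L T /
            transferSpectralRadius (fundamentalLatticeRep 2).ρ β L ^ T) ∧
        HasSum (fun i => r' i ^ T)
          (wilsonFinTorusPartition (fundamentalLatticeRep 2).ρ β' L L L T /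
            transferSpectralRadius (fundamentalLatticeRep 2).ρ β' L ^ T)) ∧
      (∀ i, i ≠ i₀ → r' i ^ (L / 4) *
        (wilsonFinTorusPartition (fundamentalLatticeRep 2).ρ β' L L L (L / 4) /
          transferSpectralRadius (fundamentalLatticeRep 2).ρ β' L ^ (L / 4)) ≤ 1)

theorem gapDominationMono_iff (L : ℕ) [NeZero L] (D : Set ℝ) :
    GapDominationMono L D ↔
      (RatioDomination L D → MonotoneOn (fun β : ℝ => coldDefect (fundamentalLatticeRep 2).ρ β L) D) :=
  Iff.rfl

/-- **(P2-sign) strong-coupling GAP CONTRACTION on `[0, β₁]`, every box** (TO-BE-PROVED; the rigorous content of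
«the tube gas uniformly in the length»: none — `t` does not occur). -/
def RatioDominationAt (β₁ : ℝ) : Prop :=
  0 < β₁ ∧ ∀ L : ℕ, 8 ≤ L → ∀ _ : NeZero L, RatioDomination L (Icc (0 : ℝ) β₁)

/-- Wiring (modus ponens, by name): gap contraction on the segment + the tilt target `GapDominationMono` for every box
⇒ MONO⁺ of `β ↦ δᶜ_β(L)` on `[0, β₁]` for every `L ≥ 8` — the same conclusion as `monotoneOn_coldDefect_of_strongCouplingSign`,
reached WITHOUT the action-defect sign and without any expansion in `t`. -/
theorem monotoneOn_coldDefect_of_ratioDomination {β₁ : ℝ} (h : RatioDominationAt β₁)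
    (hT : ∀ L : ℕ, 8 ≤ L → ∀ _ : NeZero L, GapDominationMono L (Icc (0 : ℝ) β₁)) :
    ∀ L : ℕ, 8 ≤ L →
      MonotoneOn (fun β : ℝ => coldDefect (fundamentalLatticeRep 2).ρ β L) (Icc (0 : ℝ) β₁) := by
  intro L hL
  haveI : NeZero L := ⟨by omega⟩
  exact hT L hL inferInstance (h.2 L hL inferInstance)

/-- TARGET instance of (P2-sign): tree `β₁ = 11/20` (`β_W = 1.1`, above the crossing bracket). UNCERTIFIED. -/
def RatioDominationTarget : Prop := RatioDominationAt (11 / 20)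

/-- Band-resolved dressed main term of the action defect on the box `L³ × (t, 2t)`, `t = ⌊L/4⌋`:
`Σ_{b ∈ B} Σ_{p ∈ (ℤ/L)³} 2·t·w_b(β,p)^{t−1}·∂_β w_b(β,p)·(1 − w_b(β,p)^t)` — the β-derivative of the free gas
`Σ_b Σ_p (2 w_b^t − w_b^{2t})` of glueball bands `w_b(β, ·)` on the Brillouin 3-torus sampled at the momenta of the box. -/
def dressedBandMain (B : Type) [Fintype B] (w w₁ : B → ℝ → (Fin 3 → ℝ) → ℝ) (β : ℝ) (L : ℕ) : ℝ :=
  ∑ b : B, ∑ p : (Fin 3 → Fin L),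
    2 * ((L / 4 : ℕ) : ℝ) * w b β (fun k => 2 * Real.pi * (p k : ℕ) / L) ^ (L / 4 - 1) *
      w₁ b β (fun k => 2 * Real.pi * (p k : ℕ) / L) *
      (1 - w b β (fun k => 2 * Real.pi * (p k : ℕ) / L) ^ (L / 4))

/-- **(P2-numbers) `DressedBandGasAt β₁ C` — the band-resolved dressed glueball gas, UNIFORM in `L` (typed; TO-BE-PROVED).**
A finite, `L`-INDEPENDENT set of bands `w_b(β, p)` (differentiable in `β` with derivative `w₁_b ≥ 0`, `0 ≤ w_b < 1`),
anchored to the one-plaquette tube (`|Σ_b w_b(β,p) − 3u⁴| ≤ C·u⁶`: three polarisations `A₁⁺⁺ ⊕ E⁺⁺`, flat to this order),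
such that for EVERY `L ≥ 8` the action defect is `dressedBandMain` up to the relative error `C·u(β)²`. -/
def DressedBandGasAt (β₁ C : ℝ) : Prop :=
  0 < β₁ ∧ 0 ≤ C ∧ ∃ (B : Type) (_ : Fintype B) (w w₁ : B → ℝ → (Fin 3 → ℝ) → ℝ),
    (∀ b, ∀ p, ∀ β ∈ Icc (0 : ℝ) β₁,
      HasDerivAt (fun x => w b x p) (w₁ b β p) β ∧ 0 ≤ w b β p ∧ w b β p < 1 ∧ 0 ≤ w₁ b β p) ∧
    (∀ p, ∀ β ∈ Icc (0 : ℝ) β₁, |(∑ b : B, w b β p) - 3 * uSU2 β ^ 4| ≤ C * uSU2 β ^ 6) ∧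
    ∀ L : ℕ, 8 ≤ L → ∀ β ∈ Icc (0 : ℝ) β₁,
      |actionDefectSU2 β L - dressedBandMain B w w₁ β L| ≤ C * uSU2 β ^ 2 * dressedBandMain B w w₁ β L

theorem dressedBandMain_nonneg {B : Type} [Fintype B] {w w₁ : B → ℝ → (Fin 3 → ℝ) → ℝ} {β : ℝ} (L : ℕ)
    (hw : ∀ b p, 0 ≤ w b β p ∧ w b β p < 1 ∧ 0 ≤ w₁ b β p) : 0 ≤ dressedBandMain B w w₁ β L := by
  unfold dressedBandMain
  refine Finset.sum_nonneg fun b _ => Finset.sum_nonneg fun p _ => ?_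
  obtain ⟨h0, h1, h2⟩ := hw b (fun k => 2 * Real.pi * (p k : ℕ) / L)
  have hle : w b β (fun k => 2 * Real.pi * (p k : ℕ) / L) ^ (L / 4) ≤ 1 := pow_le_one₀ h0 h1.le
  have hsub : 0 ≤ 1 - w b β (fun k => 2 * Real.pi * (p k : ℕ) / L) ^ (L / 4) := sub_nonneg.mpr hle
  have hpow : 0 ≤ w b β (fun k => 2 * Real.pi * (p k : ℕ) / L) ^ (L / 4 - 1) := pow_nonneg h0 _
  positivity

/-- **PROVED REDUCTION (P2-numbers ⇒ a-SC):** the uniform band gas with `C·u(β)² ≤ 1` on the segment gives `A_β(L) ≥ 0` for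
every `L ≥ 8`, i.e. `StrongCouplingSignSU2At β₁` (hence MONO⁺ on `[0, β₁]` via the g2 composition with p685221). -/
theorem strongCouplingSignSU2At_of_dressedBandGas {β₁ C : ℝ} (h : DressedBandGasAt β₁ C)
    (hsmall : ∀ β ∈ Icc (0 : ℝ) β₁, C * uSU2 β ^ 2 ≤ 1) : StrongCouplingSignSU2At β₁ := by
  obtain ⟨hβ₁, hC, B, _, w, w₁, hw, _hanchor, hA⟩ := h
  refine ⟨hβ₁, fun L hL β hβ => ?_⟩
  have hM : 0 ≤ dressedBandMain B w w₁ β L :=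
    dressedBandMain_nonneg L fun b p => ((hw b p β hβ).2)
  have hk : C * uSU2 β ^ 2 ≤ 1 := hsmall β hβ
  have habs := hA L hL β hβ
  have hlow : dressedBandMain B w w₁ β L - C * uSU2 β ^ 2 * dressedBandMain B w w₁ β L ≤ actionDefectSU2 β L := by
    have := (abs_sub_le_iff.mp habs).2
    linarith
  have : C * uSU2 β ^ 2 * dressedBandMain B w w₁ β L ≤ 1 * dressedBandMain B w w₁ β L :=
    mul_le_mul_of_nonneg_right hk hM
  linarith

theorem strongCouplingSignSU2_of_dressedBandGas {β₁ C : ℝ} (h : DressedBandGasAt β₁ C)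
    (hsmall : ∀ β ∈ Icc (0 : ℝ) β₁, C * uSU2 β ^ 2 ≤ 1) : StrongCouplingSignSU2 :=
  strongCouplingSignSU2_iff.mpr ⟨β₁, strongCouplingSignSU2At_of_dressedBandGas h hsmall⟩

/-! ## P3 ∕ E2-TUBE — printed predictions (GUIDANCE only; comments, no claims)

[LMP08 §3] `f(2,u) = −3/2u⁸ + 6u¹⁰ − 55u¹² + 29236/135·u¹⁴ − 78413341/43740·u¹⁶ + O(u¹⁸)`,
`f(4,u) = −3/4u¹⁶ + 6u¹⁸ − 56u²⁰ + …`; with `F_β(L) = −4L³f(2,u) + 4L³f(4,u)` (torus log-ratio, `t = 2`):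
relative orders of `F/(6L³u⁸)`: `u² : −4`, `u⁴ : 110/3` (E2 pilot ✓), `u⁶ : −58472/405 ≈ −144.37`,
`u⁸ : +1194.6` (JHEP 2008) vs `+988.6` from the PoS LAT2007 coefficients (arXiv:0710.0512) — the print itself disagrees at
order 16; the exact character-transfer computation E2-TUBE adjudicates.  None of this moves a certified ceiling (R6).
-/

end Summit.QuantumFields.YangMills.Cruxes.IRcof.SpectralTilt

end
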